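import Summits.NavierStokesRegularity.FluidComputer.RowSwitch
import HarnessLib

/-!
# `RowSwitchSound` (part 1, the TRANSFER): soundness of the RESULT inequality of the stage hand-over
# check `RowSwitch.swStageOK` given the window facts (`pub-fluidc-bp3/R1-DESIGN.md` §10.2–10.3)

HONEST FRAMING (cell `pub-fluidc`, blueprint seat bp3, gen 21): low prior, high value-of-information
experiment on Tao's machine paradigm; NOT a claim that NS blows up. Linear algebra and interval
bookkeeping only.

A stage hand-over `r | r'` re-times the member: the old row's model reads the member at `σ = s(T)`, the
new row's at `σ' = s'(T)` with `y_{p'}(σ') = X0_{p'}`, `X0 = x̂'(0) = x̂(H)` (reference continued exactly,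
checked by `swStageOK`). Writing the WINDOW FACT `y(σ') − X0 = e(T) + (σ' − σ) F(X0) + I` with
`|I_a| ≤ B_a` (`B = b 16` of the certificate; delivering it from `MemberOn` on the window is part 2, the
next seat's), this file proves the transfer: `e'(T) = P'(e(T) + I)` with `P' = I − F0 e_{p'}ᵀ/F0_{p'}`
(pure algebra, `PnR_mulVec`), `A'P' ∈ APn`, `A'P'T̂₁ ∈ L1`, `A'P'(I − T̂₁Â₁) ∈ L2` (interval soundness
from `mem_FI`, `mem_PT`, `DIVec.mem_mul`), and hence the new row's `hu0`:
`|z'(T)_i| ≤ u'_i / 2^P` (`switchStage_hu0`). No fluid mechanics and no new mathematics.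

[cite: Tao2016AveragedNS, §5.5 Thm 5.3 (5.5)]
-/

namespace Summit.NavierStokesRegularity.FluidComputer

open Literature.Analysis.FluidPDE.FluidComputer
open Literature.Analysis.ValidatedNumerics.Numerics (cdiv div_le_cdiv)

namespace RowCheck

open DIVec ChainField Finset Real Matrix

/-! ### Small facts: the reference point at local time 0, the re-timing projector -/

/-- `evalQ l 0 = l₀`. [folklore] -/
theorem evalQ_zero (l : List ℚ) : evalQ l 0 = l.getD 0 0 := by
  unfold evalQ
  cases l with
  | nil => simp
  | cons x t => simp [Finset.sum_range_succ']

/-- `x̂(0)_a = CQ_a[0]`. [folklore] -/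
theorem xh_zero (CQ : Fin 9 → List ℚ) (a : Fin 9) : xh CQ 0 a = (((CQ a).getD 0 0 : ℚ) : ℝ) := by
  have h := xh_ratCast CQ 0 a
  rw [Rat.cast_zero] at h
  rw [h, evalQ_zero]

/-- The real re-timing projector `P' = I − F0 e_pᵀ / F0_p`. [folklore] -/
noncomputable def PnR (F0 : Fin 9 → ℝ) (p : Fin 9) : Matrix (Fin 9) (Fin 9) ℝ :=
  fun a b => (if a = b then (1 : ℝ) else 0) - F0 a * (if b = p then (F0 p)⁻¹ else 0)

/-- `(P' v)_a = v_a − F0_a · v_p / F0_p`. [folklore] -/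
theorem PnR_mulVec (F0 v : Fin 9 → ℝ) (p a : Fin 9) :
    ∑ b, PnR F0 p a b * v b = v a - F0 a * ((F0 p)⁻¹ * v p) := by
  simp only [PnR, sub_mul, Finset.sum_sub_distrib, ite_mul, one_mul, zero_mul, mul_ite, mul_zero,
    Finset.sum_ite_eq, Finset.mem_univ, if_true]
  congr 1
  rw [Finset.sum_eq_single p (fun b _ hb => if_neg hb) (fun h => absurd (Finset.mem_univ p) h), if_pos rfl]
  ring

namespace RowData

variable {r r' : RowData} {c : SwCert}

/-- The new row's reference point `X0 = CQ'[·][0]` as reals. [folklore] -/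
noncomputable def X0R (r' : RowData) (a : Fin 9) : ℝ := (((r'.CQ a).getD 0 0 : ℚ) : ℝ)

/-- `X0 ∈ X0I`. [folklore] -/
theorem mem_X0I (r' : RowData) (a : Fin 9) : (r'.X0I a).mem r'.P (r'.X0R a) := by
  unfold X0I X0R CI
  cases h : r'.CQ a with
  | nil => simpa using DI.mem_pt r'.P 0
  | cons q t => simpa using mem_ofFrac r'.P q

/-- `F(X0) ∈ F0I`. [folklore] -/
theorem mem_F0I (G' : r'.GateOK) (a : Fin 9) : (r'.F0I a).mem r'.P (F G'.g G'.Λ r'.X0R a) :=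
  mem_FI G'.hU G'.hD (fun k => mem_X0I r' k) a

/-- `P' ∈ PnI`. [folklore] -/
theorem mem_PnI (G' : r'.GateOK) (hsd : signDef (r'.F0I r'.p) = true) (a b : Fin 9) :
    (r'.PnI a b).mem r'.P (PnR (F G'.g G'.Λ r'.X0R) r'.p a b) := by
  have h := r'.mem_PT (DX := Vec.mk' r'.F0I) (d := F G'.g G'.Λ r'.X0R)
    (fun i => by rw [Vec.get_mk']; exact mem_F0I G' i) (by rw [Vec.get_mk']; exact hsd) a b
  simp only [Vec.get_mk'] at h
  exact h

/-- `A'P' ∈ APn` for any frame `A' ∈ A0I'`. [folklore] -/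
theorem mem_APn (G' : r'.GateOK) (hsd : signDef (r'.F0I r'.p) = true) (Fr' : r'.Frames) (i b : Fin 9) :
    (r'.APn i b).mem r'.P ((Fr'.A0 * PnR (F G'.g G'.Λ r'.X0R) r'.p) i b) :=
  mem_mul r'.P Fr'.hA0 (mem_PnI G' hsd) i b

/-- `I − T̂₁Â₁ ∈ RoI` for any frames of the old row. [folklore] -/
theorem mem_RoI (Fr : r.Frames) (a b : Fin 9) :
    (r.RoI a b).mem r.P ((1 - Fr.T1 * Fr.A1) a b) :=
  mem_subM r.P (A := eyeI r.P) (M := (1 : Matrix (Fin 9) (Fin 9) ℝ))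
    (fun i j => by rw [Matrix.one_apply]; exact mem_eyeI r.P i j) (mem_mul r.P Fr.hT1 Fr.hA1) a b

/-- `|Σ_j M_j x_j| ≤ Σ_j ⌈mag_j · X_j / 2^P⌉ / 2^P` for `M ∈ MI` entrywise and `|x_j| ≤ X_j / 2^P`
(the kernel's rounded products bound the real ones). [folklore] -/
theorem abs_sum_le_cdiv (P : ℕ) {n : ℕ} {MI : Fin n → DI} {M x : Fin n → ℝ} {X : Fin n → ℤ}
    (hM : ∀ j, (MI j).mem P (M j)) (hx : ∀ j, |x j| ≤ (X j : ℝ) / 2 ^ P) :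
    |∑ j, M j * x j| ≤ ((∑ j, cdiv ((MI j).mag * X j) (2 ^ P) : ℤ) : ℝ) / 2 ^ P := by
  have hP : (0 : ℝ) < 2 ^ P := by positivity
  have h1 := abs_sum_mul_le M x (fun j => (X j : ℝ) / 2 ^ P) hx
  refine h1.trans ?_
  push_cast
  rw [Finset.sum_div]
  refine Finset.sum_le_sum fun j _ => ?_
  have hXj : (0 : ℝ) ≤ (X j : ℝ) / 2 ^ P := (abs_nonneg _).trans (hx j)
  have hm : |M j| ≤ ((MI j).mag : ℝ) / 2 ^ P := DI.abs_le_mag (hM j)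
  calc |M j| * ((X j : ℝ) / 2 ^ P) ≤ ((MI j).mag : ℝ) / 2 ^ P * ((X j : ℝ) / 2 ^ P) :=
        mul_le_mul_of_nonneg_right hm hXj
    _ = (((MI j).mag * X j : ℤ) : ℝ) / (((2 : ℤ) ^ P : ℤ) : ℝ) / 2 ^ P := by push_cast; ring
    _ ≤ ((cdiv ((MI j).mag * X j) (2 ^ P) : ℤ) : ℝ) / 2 ^ P :=
        div_le_div_of_nonneg_right (div_le_cdiv (by positivity)) hP.le

/-! ### The transfer theorem -/

/-- **Soundness of the stage hand-over's RESULT** (`hu0` of the new row from the window facts): if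
`swStageOK r r' c`, the old row's model (member data `m`) has its frame coordinates in the certified end
box, its deviation in `Ē` and its phase component locked (`e_p = 0`, `MemberOn.e_phase`) at
`T = T₀ + H`, the new member data `m'` is the same member re-timed (`m'.y = m.y`), and at `T` the
WINDOW FACTS hold — `y(σ') − X0 = e(T) + (σ' − σ) F(X0) + I` with `|I| ≤ B = b 16` and
`y_{p'}(σ') = X0_{p'}` (`σ = m.s T`, `σ' = m'.s T`) — then the new row's model (canonical frames,
started at `T` with `m'`) has its frame coordinates in the start box `u'` at `T`. [folklore] -/
theorem switchStage_hu0 (hs : swStageOK r r' c = true) (h : r.framesOK = true) (hl : r.lockOK = true)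
    (h' : r'.framesOK = true) (G : r.GateOK) (G' : r'.GateOK) (T0 : ℝ) (m m' : MemberData)
    (hy : m'.y = m.y) (hH : (r.Hq : ℝ) ≠ 0)
    (hz : ∀ i, |(toModel (canon h) G T0 m).z (T0 + r.Hq) i| ≤ r.ubR (2 ^ r.msub) i)
    (he : ∀ a, |(toModel (canon h) G T0 m).e (T0 + r.Hq) a| ≤ r.EbarR a)
    (hep : (toModel (canon h) G T0 m).e (T0 + r.Hq) r.p = 0)
    (I : Fin 9 → ℝ) (hI : ∀ a, |I a| ≤ ((c.b (Fin.last 16) a : ℤ) : ℝ) / 2 ^ r'.P)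
    (hd : ∀ a, m.y (m'.s (T0 + r.Hq)) a - r'.X0R a =
      (toModel (canon h) G T0 m).e (T0 + r.Hq) a +
        (m'.s (T0 + r.Hq) - m.s (T0 + r.Hq)) * F G'.g G'.Λ r'.X0R a + I a)
    (hdp : m.y (m'.s (T0 + r.Hq)) r'.p = r'.X0R r'.p) :
    ∀ i, |(toModel (canon h') G' (T0 + r.Hq) m').z (T0 + r.Hq) i| ≤ r'.ubR 0 i := by
  obtain ⟨hP, -, hsd, hres⟩ := swStageOK_parts hs
  set T := T0 + r.Hq with hT
  set R := toModel (canon h) G T0 m with hR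
  set R' := toModel (canon h') G' T m' with hR'
  set F0 : Fin 9 → ℝ := F G'.g G'.Λ r'.X0R with hF0
  set Pn := PnR F0 r'.p with hPn
  set A' : Matrix (Fin 9) (Fin 9) ℝ := (canon h').A0 with hA'
  set M : Matrix (Fin 9) (Fin 9) ℝ := A' * Pn with hM
  set v : Fin 9 → ℝ := fun b => R.e T b + I b with hv
  have hP0 : (0 : ℝ) < 2 ^ r'.P := by positivity
  -- `F0_{p'} ≠ 0`
  have hΦ : F0 r'.p ≠ 0 := (r'.abs_ge_of_signDef hsd (mem_F0I G' r'.p)).2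
  -- the new deviation at `T` is `d := y(σ') − X0 = P'(e + I)`
  have hee : ∀ a, R'.e T a = m.y (m'.s T) a - r'.X0R a := by
    intro a
    simp only [hR', RowModel.e, toModel, sub_self, xh_zero, X0R, hy]
  have hsig : m'.s T - m.s T = -((F0 r'.p)⁻¹ * v r'.p) := by
    have h0 := hd r'.p
    rw [hdp, sub_self] at h0
    have h1 : (m'.s T - m.s T) * F0 r'.p = -(R.e T r'.p + I r'.p) := by linarith
    rw [hv]
    field_simp
    linarith
  have hdP : ∀ a, R'.e T a = ∑ b, Pn a b * v b := by
    intro a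
    rw [hee, hd a, hPn, PnR_mulVec, hsig]
    simp only [hv]
    ring
  -- `z'(T)_i = (M v)_i = (M e)_i + (M I)_i`
  have hAm' : ∀ i a, R'.Am T i a = A' i.succ a := by
    intro i a
    simp only [hR', toModel, sub_self, zero_div, Av_zero, hA']
  intro i
  have hz' : R'.z T i = (M *ᵥ R.e T) i.succ + (M *ᵥ I) i.succ := by
    have h1 : R'.z T i = (A' *ᵥ R'.e T) i.succ := by
      simp only [RowModel.z, Matrix.mulVec, dotProduct, hAm']
    have h2 : R'.e T = Pn *ᵥ v := by
      ext a; rw [hdP]; simp only [Matrix.mulVec, dotProduct]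
    rw [h1, h2, Matrix.mulVec_mulVec, ← hM]
    have h3 : v = R.e T + I := by ext b; simp [hv]
    rw [h3, Matrix.mulVec_add, Pi.add_apply]
  -- the `e`-part through the old frame: `M e = (M T̂₁)(Â₁ e) + M (1 − T̂₁Â₁) e`, `(Â₁ e)₀ = 0`
  have hAm : ∀ j k, R.Am T j k = (canon h).A1 j.succ k := by
    intro j k
    simp only [hR, hT, toModel, add_sub_cancel_left, div_self hH, Av_one]
  have hzj : ∀ j : Fin 8, ((canon h).A1 *ᵥ R.e T) j.succ = R.z T j := by
    intro j; simp only [RowModel.z, Matrix.mulVec, dotProduct, hAm]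
  have hz0 : ((canon h).A1 *ᵥ R.e T) 0 = 0 := by
    simp only [Matrix.mulVec, dotProduct]
    refine Finset.sum_eq_zero fun k _ => ?_
    by_cases hk : k = r.p
    · rw [hk]
      have : R.e T r.p = 0 := hep
      rw [this, mul_zero]
    · rw [(canon_hrow h hl k hk).2, zero_mul]
  have hMe : (M *ᵥ R.e T) i.succ = ∑ j : Fin 8, (M * (canon h).T1) i.succ j.succ * R.z T j +
      ∑ k, (M * (1 - (canon h).T1 * (canon h).A1)) i.succ k * R.e T k := by
    have hmat : M *ᵥ R.e T = (M * (canon h).T1) *ᵥ ((canon h).A1 *ᵥ R.e T) +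
        (M * (1 - (canon h).T1 * (canon h).A1)) *ᵥ R.e T := by
      rw [Matrix.mulVec_mulVec, Matrix.mul_sub, Matrix.mul_one, Matrix.sub_mulVec, ← Matrix.mul_assoc]
      abel
    rw [hmat, Pi.add_apply]
    congr 1
    rw [Matrix.mulVec, dotProduct, Fin.sum_univ_succ, hz0, mul_zero, zero_add]
    simp only [hzj]
  -- entrywise interval memberships
  have hAPn : ∀ a b, (r'.APn a b).mem r'.P (M a b) := mem_APn G' hsd (canon h')
  have hT1 : ∀ a l, (r.T1I a l).mem r'.P ((canon h).T1 a l) := by rw [hP]; exact (canon h).hT1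
  have hRo : ∀ a l, (r.RoI a l).mem r'.P ((1 - (canon h).T1 * (canon h).A1) a l) := by
    rw [hP]; exact mem_RoI (canon h)
  have hL1 : ∀ j : Fin 8, (DIVec.mul r'.P r'.APn r.T1I i.succ j.succ).mem r'.P
      ((M * (canon h).T1) i.succ j.succ) := fun j => mem_mul r'.P hAPn hT1 i.succ j.succ
  have hL2 : ∀ k : Fin 9, (DIVec.mul r'.P r'.APn r.RoI i.succ k).mem r'.P
      ((M * (1 - (canon h).T1 * (canon h).A1)) i.succ k) := fun k => mem_mul r'.P hAPn hRo i.succ k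
  -- the boxes, in `2^P'` units
  have hub : ∀ j : Fin 8, |R.z T j| ≤ ((r.rowCheck.uNext.get j : ℤ) : ℝ) / 2 ^ r'.P := by
    intro j
    have := hz j
    rwa [ubR, ← uNext_eq, toR, ← hP] at this
  have heb : ∀ k : Fin 9, |R.e T k| ≤ ((r.Eb k : ℤ) : ℝ) / 2 ^ r'.P := by
    intro k
    have := he k
    rwa [EbarR, toR, ← hP] at this
  have b1 := abs_sum_le_cdiv r'.P (MI := fun j : Fin 8 => DIVec.mul r'.P r'.APn r.T1I i.succ j.succ) hL1 hub
  have b2 := abs_sum_le_cdiv r'.P (MI := fun k : Fin 9 => DIVec.mul r'.P r'.APn r.RoI i.succ k) hL2 heb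
  have b3 := abs_sum_le_cdiv r'.P (MI := fun b : Fin 9 => r'.APn i.succ b) (fun b => hAPn i.succ b) hI
  have hMI : (M *ᵥ I) i.succ = ∑ b, M i.succ b * I b := rfl
  rw [hz', hMe, hMI, ubR_zero, toR]
  have hq : ((∑ j : Fin 8, cdiv ((DIVec.mul r'.P r'.APn r.T1I i.succ j.succ).mag *
        r.rowCheck.uNext.get j) (2 ^ r'.P) : ℤ) : ℝ) +
      ((∑ k, cdiv ((DIVec.mul r'.P r'.APn r.RoI i.succ k).mag * r.Eb k) (2 ^ r'.P) : ℤ) : ℝ) +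
      ((∑ a, cdiv ((r'.APn i.succ a).mag * c.b (Fin.last 16) a) (2 ^ r'.P) : ℤ) : ℝ) ≤
      ((r'.u i.succ : ℤ) : ℝ) := by
    have := hres i
    have h1 : ((∑ j : Fin 8, cdiv ((DIVec.mul r'.P r'.APn r.T1I i.succ j.succ).mag *
        r.rowCheck.uNext.get j) (2 ^ r'.P) +
      ∑ k, cdiv ((DIVec.mul r'.P r'.APn r.RoI i.succ k).mag * r.Eb k) (2 ^ r'.P) +
      ∑ a, cdiv ((r'.APn i.succ a).mag * c.b (Fin.last 16) a) (2 ^ r'.P) + 1 : ℤ) : ℝ) ≤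
      ((r'.u i.succ : ℤ) : ℝ) := by exact_mod_cast this
    push_cast at h1 ⊢
    linarith
  rw [hP] at hP0 ⊢
  rw [← hP] at hP0
  calc |_| ≤ |(∑ j : Fin 8, (M * (canon h).T1) i.succ j.succ * R.z T j +
          ∑ k, (M * (1 - (canon h).T1 * (canon h).A1)) i.succ k * R.e T k)| +
        |∑ b, M i.succ b * I b| := abs_add_le _ _
    _ ≤ (|∑ j : Fin 8, (M * (canon h).T1) i.succ j.succ * R.z T j| +
          |∑ k, (M * (1 - (canon h).T1 * (canon h).A1)) i.succ k * R.e T k|) +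
        |∑ b, M i.succ b * I b| := by gcongr; exact abs_add_le _ _
    _ ≤ _ := by
      rw [hP] at b1 b2 b3 hq
      have := add_le_add (add_le_add b1 b2) b3
      refine this.trans ?_
      rw [← add_div, ← add_div]
      exact div_le_div_of_nonneg_right hq (by positivity)

end RowData

end RowCheck

end Summit.NavierStokesRegularity.FluidComputer
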